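import Summits.AtomisticToContinuum.HydrodynamicLimit.Theorems.OneFlightGossipEngineEnergyCurrentTailsPedigreeLevelInclusion
import Summits.AtomisticToContinuum.HydrodynamicLimit.Theorems.OneFlightGossipEngineEnergyCurrentTailsLevelCensusClosure
import Summits.AtomisticToContinuum.HydrodynamicLimit.Theorems.OneFlightGossipEngineEnergyCurrentTailsLevelCensusLedger
import Summits.AtomisticToContinuum.HydrodynamicLimit.Theorems.JParityClosureEvenStressEnskogExchangeable
import Literature.MathematicalPhysics.KineticTheory.HardSphereTwoTimePressure
import Literature.Analysis.FluidPDE.HardSphereUniqueness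
import Literature.Analysis.FluidPDE.HardSphereTorusMeasure
import Literature.Analysis.FluidPDE.HardSphereRegularGeometry
import HarnessLib

/-!
# The merge-intake stub is dominated by the one-time census
# (line `pedigree-perpetuity`, crux `EnergyCurrentTails`, stmt-AtomisticToContinuum-9235)

Support file (`--supports stmt-AtomisticToContinuum-9235`) of the line lead's seat c3 for the
registered crux-strength stub `stub_mergeIntakeTails : MergeIntakeTails` (vocabulary
`…Theorems.OneFlightGossipEngineEnergyCurrentTailsPedigreeObjects`).  It does NOT prove the stub; it
proves the registered helper `mergeIntakeTails_of_gaussianCensusBound : LineageLedgerSure →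
EnergyCurrentTailsLevelCensus.GaussianCensusBound → MergeIntakeTails`: the merge-intake tails of ONE
backward lineage follow from the sibling line's transfer statement C⁺ (`level-census-comparison`, seat
c2: `n_s(E) ≤ B(N+1)e^{−αE}`, itself the conclusion of its landed `stub_censusClosure` from
`RateCeiling`, `MergeCeiling`, `SplitFloor` — corollary `mergeIntakeTails_of_levelCensusStubs`), given
this line's sure kinematic ledger (registered stub `stub_lineageLedgerSure`).

THE FINDING.  The discounted warm intake is SURELY dominated by the current energy: on the good set,
`Λ = Σ_{genuine n} (E_n − s_n E^{proj}_n − Θ₀)₊ w_n ≤ Σ_{n<K*} (E_n − s_n E_{n+1}) w_n = E_0 − w_{K*}E_{K*}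
≤ E_0` (`warmIntake_le_energy_zero`: the perpetuity IDENTITY with `E_{n+1} = E^{proj}_n`, plus the
LOWER packet bound `s_n E^{proj}_n ≤ E_n`, `lowerPacket_share_mul_projEnergy_le_energy`, valid because a genuine
transition is a contact record, `norm_impactVec_brecord_eq_one_of_genuine`), and `E_0 = ‖v_i(s)‖²` off the null event
that `i` collides exactly at `s` (a null event, `measure_participates_flow_null`).  So
`P(Λ ≥ LΘ₀) ≤ P(‖v_i(s)‖² ≥ LΘ₀) = levelCensus/(N+1)` (exchangeability + label-blindness of the flow,
`card_mul_measure_level_eq_levelCensus`): ANY super-quintic one-time one-particle velocity tail bound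
implies `MergeIntakeTails` — the stub is census-strength and carries no lineage information beyond the
census it is meant to prove.  Also `Λ = 0` for `s ≤ 0` (`warmIntake_eq_zero_of_time_nonpos`).
References: Gallagher–Saint-Raymond–Texier 2013 §4.1 (collision records); elementary bookkeeping. -/

noncomputable section

open MeasureTheory Set Filter
open scoped ENNReal InnerProductSpace BigOperators

namespace Summit.AtomisticToContinuum.HydrodynamicLimit.Theorems.EnergyCurrentTailsPedigree

open Literature.MathematicalPhysics.KineticTheory Literature.Analysis.FluidPDE

/-! ## §1 Discounted lifts are dominated by the current energy; the lower packet bound -/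

/-- **Discounted lifts are at most the current energy** (abstract perpetuity identity).  For real
sequences `E` (energies), `sh ≥ 0` (shares), `P` (projectile energies) with `E (n+1) = P n` and the
LOWER packet bound `sh n * P n ≤ E n` for `n < K`, `0 ≤ E K`, and a threshold `Θ₀ ≥ 0`:
`Σ_{n<K} (E n − sh n P n − Θ₀)₊ Π_{j<n} sh j ≤ E 0`. -/
theorem sum_lift_mul_weight_le_energy_zero (E sh P : ℕ → ℝ) (Θ₀ : ℝ) (hΘ : 0 ≤ Θ₀) (h0 : ∀ n, 0 ≤ sh n)
    (K : ℕ) (hid : ∀ n, n < K → E (n + 1) = P n) (hlow : ∀ n, n < K → sh n * P n ≤ E n)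
    (hEK : 0 ≤ E K) :
    ∑ n ∈ Finset.range K, max (E n - sh n * P n - Θ₀) 0 * ∏ j ∈ Finset.range n, sh j ≤ E 0 := by
  suffices h : ∀ m, m ≤ K →
      ∑ n ∈ Finset.range m, max (E n - sh n * P n - Θ₀) 0 * ∏ j ∈ Finset.range n, sh j
        + (∏ j ∈ Finset.range m, sh j) * E m ≤ E 0 by
    nlinarith [h K le_rfl, mul_nonneg (Finset.prod_nonneg fun j (_ : j ∈ Finset.range K) => h0 j) hEK]
  intro m
  induction m with
  | zero => intro _; simp
  | succ m ih =>
    intro hm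
    have hmK : m < K := Nat.lt_of_succ_le hm
    have hlift : max (E m - sh m * P m - Θ₀) 0 ≤ E m - sh m * P m :=
      max_le (by linarith) (by linarith [hlow m hmK])
    have hmul := mul_le_mul_of_nonneg_left hlift (Finset.prod_nonneg fun j (_ : j ∈ Finset.range m) => h0 j)
    rw [Finset.sum_range_succ, Finset.prod_range_succ, hid m hmK]
    nlinarith [hmul, ih hmK.le]

/-- **Lower packet bound** (pair kinematics, unit impact vector `ω`): the followed branch keeps AT
LEAST its share of the projectile energy, `s · E^{proj} ≤ E = ‖(reflectVel ω (u,u')).1‖²`, the share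
being `1 − ⟪u,ω⟫²/‖u‖²` if the carrier is the projectile (`‖u'‖ ≤ ‖u‖`), `⟪u',ω⟫²/‖u'‖²` otherwise. -/
theorem share_mul_max_le_norm_sq_reflectVel_fst (u u' ω : V3) (hω : ‖ω‖ = 1) :
    (if ‖u'‖ ≤ ‖u‖ then 1 - ⟪u, ω⟫_ℝ ^ 2 / ‖u‖ ^ 2 else ⟪u', ω⟫_ℝ ^ 2 / ‖u'‖ ^ 2)
        * max (‖u‖ ^ 2) (‖u'‖ ^ 2) ≤ ‖(reflectVel ω (u, u')).1‖ ^ 2 := by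
  rw [norm_sq_reflectVel_fst u u' ω hω]
  split_ifs with h
  · rw [max_eq_left (pow_le_pow_left₀ (norm_nonneg _) h 2)]
    by_cases hu : ‖u‖ = 0
    · have h1 : ⟪u, ω⟫_ℝ = 0 := by rw [norm_eq_zero.1 hu, inner_zero_left]
      rw [hu, h1]
      nlinarith [sq_nonneg ⟪u', ω⟫_ℝ]
    · rw [sub_mul, div_mul_cancel₀ _ (pow_ne_zero 2 hu), one_mul]
      nlinarith [sq_nonneg ⟪u', ω⟫_ℝ]
  · push Not at h
    rw [max_eq_right (pow_le_pow_left₀ (norm_nonneg _) h.le 2),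
      div_mul_cancel₀ _ (pow_ne_zero 2 ((norm_nonneg _).trans_lt h).ne')]
    linarith [inner_sq_le_norm_sq u ω hω]

/-! ## §2 The lineage: genuine transitions are contact records; the sure domination `Λ ≤ E_0` -/

section Lineage

variable {N : ℕ}

/-- The time recursion of the lineage: `τ_{n+1} = flightStart … (c_n) (τ_n)` (unfolding). -/
private theorem ltime_succ_eq_flightStart (ε : ℝ) (γ : ℝ → Config N (Fin 3) T3) (i : Fin N) (s : ℝ) (n : ℕ) :
    ltime ε γ i s (n + 1)
      = flightStart (Torus.geometry (Fin 3)) ε γ 0 (carrier ε γ i s n) (ltime ε γ i s n) := rfl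

/-- A flight start read at a time `t ≤ a` is `a` (the window `(a, t)` is empty). -/
private theorem flightStart_eq_of_le (ε : ℝ) (γ : ℝ → Config N (Fin 3) T3) {a t : ℝ} (h : t ≤ a) (k : Fin N) :
    flightStart (Torus.geometry (Fin 3)) ε γ a k t = a := by
  rw [flightStart, Set.Ioo_eq_empty (not_lt.2 h), Set.inter_empty, insert_empty_eq, csSup_singleton]

/-- **From a non-positive time the lineage never moves**: for `s ≤ 0` no transition is genuine, so
the discounted warm intake vanishes. -/
theorem warmIntake_eq_zero_of_time_nonpos (ε : ℝ) (γ : ℝ → Config N (Fin 3) T3) (Θ₀ : ℝ) (i : Fin N)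
    {s : ℝ} (hs : s ≤ 0) : warmIntake ε γ Θ₀ i s = 0 := by
  have hle : ∀ n, ltime ε γ i s n ≤ 0 := by
    intro n
    induction n with
    | zero => exact hs
    | succ n ih => rw [ltime_succ_eq_flightStart, flightStart_eq_of_le ε γ ih]
  have hng : ∀ n, ¬ Genuine ε γ i s n := fun n h =>
    (lt_irrefl (0 : ℝ)) (by rw [Genuine, ltime_succ_eq_flightStart, flightStart_eq_of_le ε γ (hle n)] at h; exact h)
  unfold warmIntake
  simp [hng]

variable {ε : ℝ}

/-- **Genuine transitions are contact records.**  On the good set of a flow of spheres of diameter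
`0 < ε < 1/2` on `𝕋³`, at a genuine transition `n` the configuration at `τ_{n+1}` is a contact
configuration of the ordered pair (carrier, partner): the record's impact vector is a unit vector. -/
theorem norm_impactVec_brecord_eq_one_of_genuine (hε : 0 < ε) (hε2 : ε < 2⁻¹)
    (Φ : HardSphereFlow (Torus.geometry (Fin 3)) ε N)
    {z : Config N (Fin 3) T3} (hz : z ∈ Φ.good) (i : Fin N) (s : ℝ) {n : ℕ}
    (hn : Genuine ε (fun r => Φ.flow r z) i s n) :
    ‖(brecord ε (fun r => Φ.flow r z) i s n).impactVec‖ = 1 := by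
  have hpart : Participates (Torus.geometry (Fin 3)) ε
      (Φ.flow (ltime ε (fun r => Φ.flow r z) i s (n + 1)) z)
      (carrier ε (fun r => Φ.flow r z) i s n) := by
    rcases mem_insert_iff.1 ((Φ.isTrajectory z hz).flightStart_mem 0
      (carrier ε (fun r => Φ.flow r z) i s n) (ltime ε (fun r => Φ.flow r z) i s n)) with h0 | h
    · exact absurd h0.symm (ne_of_lt hn)
    · exact h.1
  rcases collide_partner hpart with h | h
  · exact HardSphereCollisionRecord.norm_ofConfig_impactVec hε _ (mem_contactPairs.1 h).2
  · exact HardSphereCollisionRecord.norm_ofConfig_impactVec hε _ (mem_contactPairs.1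
      ((swap_mem_contactPairs_iff (Torus.isHardSphereRegular_geometry hε2) (p := (_, _))).1 h)).2

/-- **Lower packet bound along the lineage** (the kinematic clause the domination needs beyond the
ledger): at a genuine transition, `s_n · E^{proj}_n ≤ E_n` on the good set (`0 < ε < 1/2`). -/
theorem lowerPacket_share_mul_projEnergy_le_energy (hε : 0 < ε) (hε2 : ε < 2⁻¹)
    (Φ : HardSphereFlow (Torus.geometry (Fin 3)) ε N)
    {z : Config N (Fin 3) T3} (hz : z ∈ Φ.good) (i : Fin N) (s : ℝ) {n : ℕ}
    (hn : Genuine ε (fun r => Φ.flow r z) i s n) :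
    share ε (fun r => Φ.flow r z) i s n * projEnergy ε (fun r => Φ.flow r z) i s n
      ≤ energy ε (fun r => Φ.flow r z) i s n := by
  have hω := norm_impactVec_brecord_eq_one_of_genuine hε hε2 Φ hz i s hn
  unfold share projEnergy energy
  set R := brecord ε (fun r => Φ.flow r z) i s n with hR
  have hpre : R.preVel = reflectVel R.impactVec R.postVel := by
    rw [hR, brecord, HardSphereCollisionRecord.ofConfig_preVel,
      HardSphereCollisionRecord.ofConfig_impactVec, HardSphereCollisionRecord.ofConfig_postVel,
      reflectVel_smul (inv_ne_zero hε.ne')]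
  rw [show R.postVel = reflectVel R.impactVec R.preVel by rw [hpre, reflectVel_reflectVel]]
  exact share_mul_max_le_norm_sq_reflectVel_fst _ _ _ hω

variable {σ : ℝ}

/-- **SURE DOMINATION `Λ ≤ E_0`.**  Given the sure kinematic ledger, on the good set, for `s > 0`,
`0 < σ < 1/2` and a threshold `Θ₀ ≥ 0`, the discounted warm intake of the lineage of `(i, s)` is at
most the carried energy `E_0` of its state `0` (the energy of `i` on its flight current before `s`):
perpetuity IDENTITY `E_0 = Σ_{n<K*} w_n (E_n − s_n E_{n+1}) + w_{K*} E_{K*}` with every bracket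
`≥ 0` (lower packet bound) and `≥` its lift. -/
theorem warmIntake_le_energy_zero (hL : LineageLedgerSure) (hσ : 0 < σ) (hσ2 : σ < 2⁻¹)
    (Φ : HardSphereFlow (Torus.geometry (Fin 3)) (hsDiameter σ N) (N + 1))
    {z : Config (N + 1) (Fin 3) T3} (hz : z ∈ Φ.good) (i : Fin (N + 1)) {s : ℝ} (hs : 0 < s)
    {Θ₀ : ℝ} (hΘ : 0 ≤ Θ₀) :
    warmIntake (hsDiameter σ N) (fun r => Φ.flow r z) Θ₀ i s
      ≤ energy (hsDiameter σ N) (fun r => Φ.flow r z) i s 0 := by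
  obtain ⟨hK0, hK, -, hD, hex, -⟩ := (hL σ N Φ).1 z hz i s hs
  have hε2 : hsDiameter σ N < 2⁻¹ := (hsDiameter_le hσ.le N).trans_lt hσ2
  have hiff := StubLevelInclusion.genuine_iff_lt_termIndex (hsDiameter σ N) (fun r => Φ.flow r z) i s hD hex
  rw [StubLevelInclusion.warmIntake_eq_sum (hsDiameter σ N) (fun r => Φ.flow r z) i s Θ₀ hiff]
  unfold lift weight
  refine sum_lift_mul_weight_le_energy_zero _ _ _ Θ₀ hΘ (fun n => (hK0 n).1) _
    (fun n hn => (hK n ((hiff n).2 hn)).2.2.1)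
    (fun n hn => lowerPacket_share_mul_projEnergy_le_energy (hsDiameter_pos hσ N) hε2 Φ hz i s ((hiff n).2 hn)) ?_
  unfold energy
  positivity

end Lineage

/-! ## §3 From the one-time census to the merge-intake tails -/

section Census

variable {σ : ℝ} {N : ℕ}

/-- **Colliding at a fixed time is a null event** (local copy of the line's landed
`measure_participates_flow_eq_zero`, file `…PedigreeAssemblyNull`, whose olean is not yet served):
`λ_N {z | i participates in a collision of Φ_s z} = 0` — contact sets are Lebesgue-null on the torus,
`Φ_s` preserves the Liouville measure, and the local Gibbs law is absolutely continuous w.r.t. it. -/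
private theorem measure_participates_flow_null (hσ : 0 < σ) (a₀ θ₀ : T3 → ℝ) (u₀ : T3 → V3)
    (Φ : HardSphereFlow (Torus.geometry (Fin 3)) (hsDiameter σ N) (N + 1)) (s : ℝ)
    (i : Fin (N + 1)) :
    localGibbsLaw σ a₀ u₀ θ₀ N Φ
        {z | Participates (Torus.geometry (Fin 3)) (hsDiameter σ N) (Φ.flow s z) i} = 0 := by
  have hε : hsDiameter σ N ≠ 0 := (hsDiameter_pos hσ N).ne'
  -- a measurable null superset `C` of the participation event of `i`
  set C : Set (Config (N + 1) (Fin 3) T3) := ⋃ j : Fin (N + 1),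
    ((if i ≠ j then contactSet (Torus.geometry (Fin 3)) (N + 1) (hsDiameter σ N) i j else ∅) ∪
      (if j ≠ i then contactSet (Torus.geometry (Fin 3)) (N + 1) (hsDiameter σ N) j i else ∅)) with hC
  have hcs : ∀ k l : Fin (N + 1),
      MeasurableSet (if k ≠ l then contactSet (Torus.geometry (Fin 3)) (N + 1) (hsDiameter σ N) k l else ∅)
      ∧ volume (if k ≠ l then contactSet (Torus.geometry (Fin 3)) (N + 1) (hsDiameter σ N) k l else ∅)
        = 0 := fun k l => by
    split_ifs with hkl
    · exact ⟨measurableSet_contactSet _ Torus.measurable_geometry_sepVec _ _ _ _,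
        volume_contactSet hε hkl⟩
    · exact ⟨MeasurableSet.empty, measure_empty⟩
  have hmeasC : MeasurableSet C := MeasurableSet.iUnion fun j => (hcs i j).1.union (hcs j i).1
  have hvolC : volume C = 0 := measure_iUnion_null fun j => measure_union_null (hcs i j).2 (hcs j i).2
  have hliouC : liouville (Torus.geometry (Fin 3)) (N + 1) (hsDiameter σ N) C = 0 := by
    rw [liouville_eq]
    exact nonpos_iff_eq_zero.1 ((Measure.le_iff'.1 Measure.restrict_le_self _).trans hvolC.le)
  have hpre := (Φ.measurePreserving s).measure_preimage hmeasC.nullMeasurableSet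
  rw [hliouC] at hpre
  refine measure_mono_null ?_ ((localGibbsLaw_absolutelyContinuous σ a₀ u₀ θ₀ N Φ) hpre)
  rintro z ⟨j, h | h⟩
  · exact mem_iUnion.2 ⟨j, Or.inl (by rw [if_pos (mem_contactPairs.1 h).1]; exact (mem_contactPairs.1 h).2)⟩
  · exact mem_iUnion.2 ⟨j, Or.inr (by rw [if_pos (mem_contactPairs.1 h).1]; exact (mem_contactPairs.1 h).2)⟩

/-- **One particle's level probability is the census per particle**: by exchangeability of the
local Gibbs law (`measurePreserving_comp_perm_localGibbsLaw`) and label-blindness of the flow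
(`HardSphereFlow.flow_comp_perm_ae`), `(N+1) · λ_N{E < ‖v_i(s)‖²} = levelCensus s E` for every `i`. -/
theorem card_mul_measure_level_eq_levelCensus (a₀ θ₀ : T3 → ℝ) (u₀ : T3 → V3)
    (Φ : HardSphereFlow (Torus.geometry (Fin 3)) (hsDiameter σ N) (N + 1)) (s E : ℝ)
    (i : Fin (N + 1)) :
    ((N : ℝ≥0∞) + 1) * localGibbsLaw σ a₀ u₀ θ₀ N Φ {z | E < ‖(Φ.flow s z i).2‖ ^ 2}
      = EnergyCurrentTailsLevelCensus.levelCensus σ a₀ θ₀ u₀ N Φ s E := by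
  have hmeasv : ∀ l : Fin (N + 1), Measurable fun z : Config (N + 1) (Fin 3) T3 => (Φ.flow s z l).2 :=
    fun l => ((measurable_pi_apply l).comp (Φ.measurable_flow s)).snd
  have hV : MeasurableSet {v : V3 | E < ‖v‖ ^ 2} :=
    measurableSet_lt measurable_const (measurable_norm.pow_const 2)
  have hA : ∀ l : Fin (N + 1),
      MeasurableSet {z : Config (N + 1) (Fin 3) T3 | E < ‖(Φ.flow s z l).2‖ ^ 2} :=
    fun l => measurableSet_lt measurable_const ((hmeasv l).norm.pow_const 2)
  -- all one-particle level probabilities coincide with that of `i`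
  have hswap : ∀ l : Fin (N + 1), localGibbsLaw σ a₀ u₀ θ₀ N Φ {z | E < ‖(Φ.flow s z l).2‖ ^ 2}
      = localGibbsLaw σ a₀ u₀ θ₀ N Φ {z | E < ‖(Φ.flow s z i).2‖ ^ 2} := by
    intro l
    have hae : ∀ᵐ z ∂(localGibbsLaw σ a₀ u₀ θ₀ N Φ), Φ.flow s (z ∘ Equiv.swap i l)
        = (Φ.flow s z ∘ Equiv.swap i l : Config (N + 1) (Fin 3) T3) :=
      (localGibbsLaw_absolutelyContinuous σ a₀ u₀ θ₀ N Φ).ae_le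
        (Φ.flow_comp_perm_ae (Equiv.swap i l) s)
    calc localGibbsLaw σ a₀ u₀ θ₀ N Φ {z | E < ‖(Φ.flow s z l).2‖ ^ 2}
        = localGibbsLaw σ a₀ u₀ θ₀ N Φ ((fun z : Config (N + 1) (Fin 3) T3 =>
            (z ∘ Equiv.swap i l : Config (N + 1) (Fin 3) T3)) ⁻¹' {z | E < ‖(Φ.flow s z i).2‖ ^ 2}) := by
          refine measure_congr ?_
          filter_upwards [hae] with z hz
          change (E < ‖(Φ.flow s z l).2‖ ^ 2) = (E < ‖(Φ.flow s (z ∘ Equiv.swap i l) i).2‖ ^ 2)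
          rw [hz, Function.comp_apply, Equiv.swap_apply_left]
      _ = localGibbsLaw σ a₀ u₀ θ₀ N Φ {z | E < ‖(Φ.flow s z i).2‖ ^ 2} :=
          (EvenStressEnskog.measurePreserving_comp_perm_localGibbsLaw σ a₀ θ₀ u₀ N Φ
            (Equiv.swap i l)).measure_preimage (hA i).nullMeasurableSet
  have hcensus : EnergyCurrentTailsLevelCensus.levelCensus σ a₀ θ₀ u₀ N Φ s E
      = ∑ l : Fin (N + 1), localGibbsLaw σ a₀ u₀ θ₀ N Φ {z | E < ‖(Φ.flow s z l).2‖ ^ 2} := by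
    unfold EnergyCurrentTailsLevelCensus.levelCensus
    rw [lintegral_finsetSum Finset.univ
      (f := fun l z => Set.indicator {v : V3 | E < ‖v‖ ^ 2} (fun _ => (1 : ℝ≥0∞)) ((Φ.flow s z l).2))
      (fun l _ => (measurable_const.indicator hV).comp (hmeasv l))]
    refine Finset.sum_congr rfl fun l _ => ?_
    have : (fun z : Config (N + 1) (Fin 3) T3 =>
        Set.indicator {v : V3 | E < ‖v‖ ^ 2} (fun _ => (1 : ℝ≥0∞)) ((Φ.flow s z l).2))
        = Set.indicator {z | E < ‖(Φ.flow s z l).2‖ ^ 2} 1 := by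
      funext z
      simp only [Set.indicator_apply, Set.mem_setOf_eq, Pi.one_apply]
    rw [this, lintegral_indicator_one (hA l)]
  rw [hcensus, Finset.sum_congr rfl fun l _ => hswap l, Finset.sum_const, Finset.card_univ,
    Fintype.card_fin, nsmul_eq_mul]
  push_cast
  ring

/-- An elementary exponential-versus-power bound: `e^{−x} ≤ 120 / x⁵` for `x > 0` (`x⁵/5! ≤ eˣ`). -/
private theorem exp_neg_le_div_pow_five_of_pos {x : ℝ} (hx : 0 < x) : Real.exp (-x) ≤ 120 / x ^ 5 := by
  have h5 : x ^ 5 / 120 ≤ Real.exp x := by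
    have := Real.pow_div_factorial_le_exp x hx.le 5; norm_num [Nat.factorial] at this; exact this
  rw [Real.exp_neg, le_div_iff₀ (pow_pos hx 5), inv_mul_le_iff₀ (Real.exp_pos _)]
  linarith

/-- **THE MERGE-INTAKE TAILS FOLLOW FROM THE GAUSSIAN CENSUS BOUND** (registered helper of the stub
`stub_mergeIntakeTails`, line `pedigree-perpetuity`): the sure kinematic ledger of the lineage
(`LineageLedgerSure`, registered stub `stub_lineageLedgerSure`) and the transfer statement C⁺ of the
sibling line `level-census-comparison` (`GaussianCensusBound`: `n_s(E) ≤ B(N+1)e^{−αE}` for `E ≥ E₀`)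
imply `P(Λ ≥ LΘ₀) ≤ B₁L⁻⁵` with `Θ₀ := max E₀ 0 + 1`, `B₁ := max B 0 · e^α · 120/(αΘ₀)⁵`.  Route: sure
domination `Λ ≤ E_0 = ‖v_i(s)‖²` off two null events, exchangeability, the census at the level
`LΘ₀ − 1 ≥ E₀`, and `e^{−x} ≤ 120x⁻⁵`; at `s = 0` the event is empty.  So `MergeIntakeTails` is a
WEAKENING of any super-quintic one-time, one-particle velocity tail bound. -/
theorem mergeIntakeTails_of_gaussianCensusBound : LineageLedgerSure → Summit.AtomisticToContinuum.HydrodynamicLimit.Theorems.EnergyCurrentTailsLevelCensus.GaussianCensusBound → MergeIntakeTails := by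
  intro hL hC a₀ θ₀ u₀ ha hθ hu ha0 hθ0
  obtain ⟨σ₀, hσ₀, hCσ⟩ := hC a₀ θ₀ u₀ ha hθ hu ha0 hθ0
  refine ⟨min σ₀ 2⁻¹, lt_min hσ₀ (by norm_num), fun σ hσ hσlt T ρ θ u hE Φ hlim t ht => ?_⟩
  have hσ2 : σ < 2⁻¹ := hσlt.trans_le (min_le_right _ _)
  obtain ⟨α, hα, B, E₀, N₀, hcen⟩ :=
    hCσ σ hσ (hσlt.trans_le (min_le_left _ _)) T ρ θ u hE Φ hlim t ht
  have hΘpos : 0 < max E₀ 0 + 1 := by positivity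
  refine ⟨max E₀ 0 + 1, hΘpos,
    max B 0 * Real.exp α * 120 / (α * (max E₀ 0 + 1)) ^ 5, N₀, fun N hN s hs i L hL1 => ?_⟩
  have hLreal : (1 : ℝ) ≤ L := by exact_mod_cast hL1
  rcases eq_or_lt_of_le hs.1 with hs0 | hs0
  · -- `s = 0`: no transition is genuine, `Λ = 0 < L Θ₀`, the event is empty
    have hempty : {z : Config (N + 1) (Fin 3) T3 | (L : ℝ) * (max E₀ 0 + 1)
        ≤ warmIntake (hsDiameter σ N) (fun r => (Φ N).flow r z) (max E₀ 0 + 1) i s} = ∅ := by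
      ext z
      simp only [Set.mem_setOf_eq, Set.mem_empty_iff_false, iff_false, not_le]
      rw [warmIntake_eq_zero_of_time_nonpos _ _ _ _ hs0.symm.le]
      positivity
    rw [hempty, measure_empty]
    exact bot_le
  · -- `s > 0`
    have hEL0 : E₀ ≤ (L : ℝ) * (max E₀ 0 + 1) - 1 := by
      have h1 : max E₀ 0 + 1 ≤ (L : ℝ) * (max E₀ 0 + 1) := le_mul_of_one_le_left hΘpos.le hLreal
      linarith [le_max_left E₀ 0]
    -- Step 1: sure domination off two null events
    have hstep1 : localGibbsLaw σ a₀ u₀ θ₀ N (Φ N) {z | (L : ℝ) * (max E₀ 0 + 1)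
          ≤ warmIntake (hsDiameter σ N) (fun r => (Φ N).flow r z) (max E₀ 0 + 1) i s}
        ≤ localGibbsLaw σ a₀ u₀ θ₀ N (Φ N)
            {z | (L : ℝ) * (max E₀ 0 + 1) - 1 < ‖((Φ N).flow s z i).2‖ ^ 2} := by
      refine measure_mono_ae ?_
      have hpart : ∀ᵐ z ∂(localGibbsLaw σ a₀ u₀ θ₀ N (Φ N)),
          ¬ Participates (Torus.geometry (Fin 3)) (hsDiameter σ N) ((Φ N).flow s z) i := by
        rw [ae_iff]
        simpa only [not_not] using measure_participates_flow_null hσ a₀ θ₀ u₀ (Φ N) s i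
      filter_upwards [ae_mem_good_localGibbsLaw σ a₀ u₀ θ₀ N (Φ N), hpart] with z hz hnp
      intro hzΛ
      have hdom := warmIntake_le_energy_zero hL hσ hσ2 (Φ N) hz i hs0 hΘpos.le
      have hE0 := ((hL σ N (Φ N)).1 z hz i s hs0).2.2.2.2.2.2.1 hnp
      have h2 : (L : ℝ) * (max E₀ 0 + 1) ≤ ‖((Φ N).flow s z i).2‖ ^ 2 := hE0 ▸ le_trans hzΛ hdom
      show (L : ℝ) * (max E₀ 0 + 1) - 1 < ‖((Φ N).flow s z i).2‖ ^ 2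
      linarith
    -- Step 2: the census bound per particle
    have hstep2 : localGibbsLaw σ a₀ u₀ θ₀ N (Φ N)
          {z | (L : ℝ) * (max E₀ 0 + 1) - 1 < ‖((Φ N).flow s z i).2‖ ^ 2}
        ≤ ENNReal.ofReal (max B 0 * Real.exp (-α * ((L : ℝ) * (max E₀ 0 + 1) - 1))) := by
      have hN1 : ((N : ℝ≥0∞) + 1) ≠ 0 := by positivity
      rw [← ENNReal.mul_le_mul_iff_right hN1 (by simp),
        card_mul_measure_level_eq_levelCensus a₀ θ₀ u₀ (Φ N) s _ i]
      refine (hcen N hN s hs _ hEL0).trans ?_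
      have hN3 : ((N : ℝ≥0∞) + 1) = ENNReal.ofReal ((N : ℝ) + 1) := by
        rw [ENNReal.ofReal_add (by positivity) zero_le_one, ENNReal.ofReal_natCast, ENNReal.ofReal_one]
      rw [hN3, ← ENNReal.ofReal_mul (by positivity)]
      refine ENNReal.ofReal_le_ofReal ?_
      have hN4 : (0 : ℝ) < (N : ℝ) + 1 := by positivity
      nlinarith [le_max_left B 0, mul_pos hN4 (Real.exp_pos (-α * ((L : ℝ) * (max E₀ 0 + 1) - 1)))]
    -- Step 3: the exponential beats the fifth power
    have hstep3 : max B 0 * Real.exp (-α * ((L : ℝ) * (max E₀ 0 + 1) - 1))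
        ≤ max B 0 * Real.exp α * 120 / (α * (max E₀ 0 + 1)) ^ 5 / (L : ℝ) ^ 5 := by
      have hx : 0 < α * (max E₀ 0 + 1) * L := by positivity
      have hrew : Real.exp (-α * ((L : ℝ) * (max E₀ 0 + 1) - 1))
          = Real.exp α * Real.exp (-(α * (max E₀ 0 + 1) * L)) := by
        rw [← Real.exp_add]; congr 1; ring
      have hL5 : (0 : ℝ) < (L : ℝ) ^ 5 := by positivity
      have hT5 : (0 : ℝ) < (α * (max E₀ 0 + 1)) ^ 5 := by positivity
      calc max B 0 * Real.exp (-α * ((L : ℝ) * (max E₀ 0 + 1) - 1))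
          = (max B 0 * Real.exp α) * Real.exp (-(α * (max E₀ 0 + 1) * L)) := by rw [hrew]; ring
        _ ≤ (max B 0 * Real.exp α) * (120 / (α * (max E₀ 0 + 1) * L) ^ 5) :=
            mul_le_mul_of_nonneg_left (exp_neg_le_div_pow_five_of_pos hx) (by positivity)
        _ = max B 0 * Real.exp α * 120 / (α * (max E₀ 0 + 1)) ^ 5 / (L : ℝ) ^ 5 := by
            rw [mul_pow]; field_simp
    exact hstep1.trans (hstep2.trans (ENNReal.ofReal_le_ofReal hstep3))

/-- **Corollary — the merge-intake stub reduces to the three dynamical stubs of the sibling line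
`level-census-comparison`** (`RateCeiling`, `MergeCeiling`, `SplitFloor`, its registered open stubs
F1–F3), through that line's landed `stub_censusLedger` and `stub_censusClosure`. -/
theorem mergeIntakeTails_of_levelCensusStubs (hL : LineageLedgerSure)
    (hF1 : EnergyCurrentTailsLevelCensus.RateCeiling) (hF2 : EnergyCurrentTailsLevelCensus.MergeCeiling)
    (hF3 : EnergyCurrentTailsLevelCensus.SplitFloor) : MergeIntakeTails :=
  mergeIntakeTails_of_gaussianCensusBound hL
    (EnergyCurrentTailsLevelCensus.stub_censusClosure EnergyCurrentTailsLevelCensus.stub_censusLedger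
      hF1 hF2 hF3)

end Census

end Summit.AtomisticToContinuum.HydrodynamicLimit.Theorems.EnergyCurrentTailsPedigree

end
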